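/-
Copyright (c) 2026. All rights reserved.
Released under Apache 2.0 license as described in the file LICENSE.
Authors: abc-iut cell, wave-4 seat abc-iut-w4-d059 (proof-only; piece (P-A′-E), vertex half: the
finite-level E-stabiliser of the standard vertex class is the pro-vertex normaliser times the level kernel).
-/
import Literature.AnabelianGeometry.SemiGraphs.SubgroupPresentationArithAction
import HarnessLib

/-!
# [SemiAnbd] Thm 5.4 (i) p. 66: the arithmetic stabiliser of the standard level vertex, modulo the level
# (proof-only)

Mochizuki, *Semi-graphs of anabelioids*, Publ. RIMS **42** (2006), §5 p. 65 / Thm 5.4 (i) p. 66 (the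
decomposition group `Π^temp_{𝔊,v}` and the finite levels of the arithmetic tower).
[cite: MochizukiSemiAnbd2006, Thm 5.4 (i) p.66]

PROOF-ONLY file (abc-iut cell, sub-DAG `plan/L3/SUBDAG-SemiAnbd-Thm54.md`, producer row T54-B, piece
(P-A′-E) of the (AI4″) producer, seat abc-iut-w4-d059) over abc-iut-L3-d4's `SubgroupPresentationArithAction`
(T1c): for the arithmetic action `P.arithAct hP N hN` of `E` on the coset graph of a `Φ`-stable normal level
`N`, and the geometric inclusion `ι : Γ → E` (`Φ (ι g) = conj g`, `σ (ι g) = 1`):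

* `exists_mul_inner_isVConj_one_of_fixes_vMk` — if `e` fixes the standard vertex class `H_{v₀} · 1 · N`,
  then `σ_e` fixes `v₀` and, after multiplying `e` by some `ι n`, `n ∈ N`, the element NORMALISES `H_{v₀}`
  through `Φ` (`IsVConj … v₀ 1`): the level-`N` stabiliser is (pro-vertex normaliser) · `ι(N)` — the input
  `hE` of `CompactOrbit.forall_apply_eq_iff_mem_map`;
* `fixes_vMk_of_isVConj_one` — conversely such elements fix the standard vertex class.

No definition; nothing here takes a side on [IUTchIII] Cor. 3.12; typed ≠ proved elsewhere.
-/

namespace Literature.AnabelianGeometry.SemiGraphs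

namespace SemiGraph

namespace SubgroupPresentation

open CategoryTheory

universe u v

variable {𝔾 : SemiGraph.{u}} {Γ : Type u} [Group Γ] (P : SubgroupPresentation 𝔾 Γ)
  {E : Type v} [Group E] {Φ : E →* MulAut Γ} {σ : E →* Aut 𝔾} (hP : P.IsArithCompatible Φ σ)
  (N : Subgroup Γ) [N.Normal] (hN : ∀ (e : E) (x : Γ), x ∈ N → Φ e x ∈ N)
  (ι : Γ →* E) (hιΦ : ∀ g : Γ, Φ (ι g) = MulAut.conj g) (hισ : ∀ g : Γ, σ (ι g) = 1)

omit [N.Normal] in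
include hιΦ hισ in
/-- **The arithmetic stabiliser of the standard level vertex, modulo the level**: if `e ∈ E` fixes the
class `H_{v₀} · 1 · N` under the arithmetic action on `P.cosetGraph N`, then `σ_e v₀ = v₀` and for some
`n ∈ N` the element `e · ι(n)` normalises `H_{v₀}` through `Φ` (vertex conjugator `1`).
[cite: MochizukiSemiAnbd2006, Thm 5.4 (i) p.66] -/
theorem exists_mul_inner_isVConj_one_of_fixes_vMk (v₀ : 𝔾.Vertex) (e : E)
    (hfix : (P.arithAct hP N hN e).hom.vertexMap (P.vMk N v₀ 1) = P.vMk N v₀ 1) :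
    (σ e).hom.vertexMap v₀ = v₀ ∧ ∃ n ∈ N, P.IsVConj Φ σ (e * ι n) v₀ 1 := by
  have hk : P.IsVConj Φ σ e v₀ (P.vConj hP e v₀) := P.isVConj_vConj hP e v₀
  rw [P.arithAct_vertexMap_vMk hP N hN hk 1] at hfix
  have hσ : (σ e).hom.vertexMap v₀ = v₀ := congrArg Sigma.fst hfix
  refine ⟨hσ, ?_⟩
  -- the class of `k⁻¹` is the class of `1`: `k = n₀ h` with `n₀ ∈ N`, `h ∈ H_{v₀}`
  set k := P.vConj hP e v₀ with hk_def
  rw [hσ, map_one, mul_one] at hfix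
  have hcl : DoubleCoset.mk (P.H v₀) N k⁻¹ = DoubleCoset.mk (P.H v₀) N 1 :=
    eq_of_heq (Sigma.mk.inj_iff.mp hfix).2
  obtain ⟨h, hh, n₀, hn₀, hkn⟩ := (DoubleCoset.eq _ _ _ _).mp hcl
  -- `1 = h * k⁻¹ * n₀`, so `k = n₀ * h`
  have hk' : k = n₀ * h := by
    have := congrArg (fun z => z * n₀⁻¹ * k) hkn
    simp only [one_mul, mul_assoc, mul_inv_cancel_left, inv_mul_cancel, mul_one] at this
    -- `this : n₀⁻¹ * k = h`
    rw [← this, mul_inv_cancel_left]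
  -- the correcting element `n := Φ_{e⁻¹}(n₀⁻¹) ∈ N`
  refine ⟨Φ e⁻¹ n₀⁻¹, hN e⁻¹ _ (N.inv_mem hn₀), ?_⟩
  -- a vertex conjugator for `e · ι n` is `Φ_e(n) · k = n₀⁻¹ n₀ h = h ∈ H_{v₀}`
  have hσ1 : (σ (ι (Φ e⁻¹ n₀⁻¹))).hom.vertexMap v₀ = v₀ := by rw [hισ]; rfl
  have h₁ : P.IsVConj Φ σ e ((σ (ι (Φ e⁻¹ n₀⁻¹))).hom.vertexMap v₀) k := by rw [hσ1]; exact hk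
  have hmul := IsVConj.mul h₁ (IsVConj.of_inner (hιΦ (Φ e⁻¹ n₀⁻¹)) (hισ _) v₀)
  have hconj : Φ e (Φ e⁻¹ n₀⁻¹) * k = h := by
    rw [← MulAut.mul_apply, ← map_mul, mul_inv_cancel, map_one, MulAut.one_apply, hk']
    group
  rw [hconj] at hmul
  -- the target vertex of `e · ι n` is `v₀`
  have hσ' : (σ (e * ι (Φ e⁻¹ n₀⁻¹))).hom.vertexMap v₀ = v₀ := by
    rw [map_mul, aut_mul_vertexMap, hσ1, hσ]
  -- replace the conjugator `h ∈ H_{v₀}` by `1`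
  intro x
  rw [hmul x, hσ', inv_one, one_mul, mul_one]
  constructor
  · intro hx
    have := (P.H v₀).mul_mem ((P.H v₀).mul_mem hh hx) ((P.H v₀).inv_mem hh)
    simpa [mul_assoc] using this
  · intro hx
    have := (P.H v₀).mul_mem ((P.H v₀).mul_mem ((P.H v₀).inv_mem hh) hx) hh
    simpa [mul_assoc] using this

include hιΦ hισ in
/-- **Conversely**: an element with `σ_e v₀ = v₀` normalising `H_{v₀}` through `Φ` fixes the standard vertex
class, and so does `e · ι(n)⁻¹`-type products with `n ∈ N` (elements of `ι(N)` act trivially).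
[cite: MochizukiSemiAnbd2006, Thm 5.4 (i) p.66] -/
theorem fixes_vMk_of_isVConj_one (v₀ : 𝔾.Vertex) (e : E) (hσ : (σ e).hom.vertexMap v₀ = v₀)
    (he : P.IsVConj Φ σ e v₀ 1) (n : Γ) (hn : n ∈ N) :
    (P.arithAct hP N hN (e * ι n)).hom.vertexMap (P.vMk N v₀ 1) = P.vMk N v₀ 1 := by
  rw [map_mul, aut_mul_vertexMap,
    P.arithAct_eq_deckAct_of_inner hP N hN (hιΦ n) (hισ n), P.deckAct_vertexMap_vMk,
    P.arithAct_vertexMap_vMk hP N hN he]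
  refine Sigma.ext hσ ?_
  -- classes: `H · Φ_e(n⁻¹) · N = H · 1 · N` since `Φ_e(n⁻¹) ∈ N`
  have hcl : DoubleCoset.mk (P.H ((σ e).hom.vertexMap v₀)) N (1⁻¹ * Φ e (1 * n⁻¹)) =
      DoubleCoset.mk (P.H ((σ e).hom.vertexMap v₀)) N 1 :=
    (DoubleCoset.eq _ _ _ _).mpr ⟨1, one_mem _, (Φ e n⁻¹)⁻¹, N.inv_mem (hN e _ (N.inv_mem hn)), by simp⟩
  rw [hσ] at hcl ⊢
  exact heq_of_eq hcl

/-! ### Levelwise transitivity (T1)/(T2) under the deck action -/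

omit hP hN in
/-- **(T1) levelwise transitivity on (vertex, branch) pairs under the deck action**: every vertex `H_{v₀} y N`
over `v₀` together with a branch `(b₀, M z N)` abutting to it is the deck-translate by `(s_{b₀} z)⁻¹` of the
standard pair `(H_{v₀} · 1 · N, (b₀, M s_{b₀}⁻¹ N))`. [cite: MochizukiSemiAnbd2006, Thm 3.7(iii) p.41] -/
theorem exists_deck_translate_vertex_branch (v₀ : 𝔾.Vertex) (b₀ : 𝔾.Branch)
    (hb₀ : 𝔾.abuts b₀ = some v₀) (y z : Γ)
    (habut : (P.cosetGraph N).abuts (P.bMk N b₀ z) = some (P.vMk N v₀ y)) :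
    ∃ g : Γ, (P.deckAct N g).hom.vertexMap (P.vMk N v₀ 1) = P.vMk N v₀ y ∧
      (P.deckAct N g).hom.branchMap (P.bMk N b₀ (P.s b₀)⁻¹) = P.bMk N b₀ z := by
  rw [P.cosetGraph_abuts_bMk N b₀ v₀ hb₀ z] at habut
  have hcl : DoubleCoset.mk (P.H v₀) N (P.s b₀ * z) = DoubleCoset.mk (P.H v₀) N y :=
    eq_of_heq (Sigma.mk.inj_iff.mp (Option.some.inj habut)).2
  refine ⟨(P.s b₀ * z)⁻¹, ?_, ?_⟩
  · rw [P.deckAct_vertexMap_vMk, inv_inv, one_mul]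
    exact congrArg (Sigma.mk v₀) hcl
  · rw [P.deckAct_branchMap_bMk, inv_inv, inv_mul_cancel_left]

omit hP hN in
/-- **(T2) levelwise transitivity of the geometric vertex group on branches at the standard vertex**: every
branch `(b₀, M z N)` abutting to `H_{v₀} · 1 · N` is the deck-translate of the standard branch
`(b₀, M s_{b₀}⁻¹ N)` by an element of `H_{v₀}` (which fixes the standard vertex class at EVERY level).
[cite: MochizukiSemiAnbd2006, Thm 3.7(iii) p.41] -/
theorem exists_mem_H_deck_translate_branch (v₀ : 𝔾.Vertex) (b₀ : 𝔾.Branch)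
    (hb₀ : 𝔾.abuts b₀ = some v₀) (z : Γ)
    (habut : (P.cosetGraph N).abuts (P.bMk N b₀ z) = some (P.vMk N v₀ 1)) :
    ∃ g ∈ P.H v₀, (P.deckAct N g).hom.branchMap (P.bMk N b₀ (P.s b₀)⁻¹) = P.bMk N b₀ z := by
  rw [P.cosetGraph_abuts_bMk N b₀ v₀ hb₀ z] at habut
  have hcl : DoubleCoset.mk (P.H v₀) N (P.s b₀ * z) = DoubleCoset.mk (P.H v₀) N 1 :=
    eq_of_heq (Sigma.mk.inj_iff.mp (Option.some.inj habut)).2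
  -- `1 = h * (s z) * n`, so `s z = h⁻¹ n⁻¹`
  obtain ⟨h, hh, n, hn, hone⟩ := (DoubleCoset.eq _ _ _ _).mp hcl
  refine ⟨h, hh, ?_⟩
  rw [P.deckAct_branchMap_bMk]
  -- classes `M s⁻¹ h⁻¹ N = M z N`: `s⁻¹ h⁻¹ = z n`
  have hz : (P.s b₀)⁻¹ * h⁻¹ = z * n := by
    have := congrArg (fun t => (P.s b₀)⁻¹ * h⁻¹ * t) hone
    simp only [mul_one, ← mul_assoc] at this
    rw [this]; group
  refine Subtype.ext (Prod.ext rfl (congrArg (Sigma.mk (𝔾.edgeOf b₀)) ?_))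
  rw [hz]
  exact (DoubleCoset.eq _ _ _ _).mpr ⟨1, one_mem _, n⁻¹, N.inv_mem hn, by group⟩

omit hP hN in
/-- Elements of `H_{v₀}` fix the standard vertex class `H_{v₀} · 1 · N` at every normal level.
[cite: MochizukiSemiAnbd2006, Thm 3.7(iii) p.41] -/
theorem deckAct_vMk_one_of_mem_H (v₀ : 𝔾.Vertex) {g : Γ} (hg : g ∈ P.H v₀) :
    (P.deckAct N g).hom.vertexMap (P.vMk N v₀ 1) = P.vMk N v₀ 1 := by
  rw [P.deckAct_vertexMap_vMk, one_mul]
  exact congrArg (Sigma.mk v₀) ((DoubleCoset.eq _ _ _ _).mpr ⟨g, hg, 1, one_mem _, by group⟩)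

end SubgroupPresentation

end SemiGraph

end Literature.AnabelianGeometry.SemiGraphs
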